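import Summits.Ventures.PercRepro.C041ZonePortLemma
import Summits.Ventures.PercRepro.C041SkeletonCount

/-!
# THEOREM R, the reduction for the red-connected-attachment family: the zone port problem of a bare colouring
(p6, gen 24; mine-3, C-041.md §3 «REDUCTION TO A PORT PROBLEM» / §6 (d), family `𝒮_rc(O)`)

A skeleton `(G; a, b, c)`; `O : Config E` a colouring of the BARE edges (at neither terminal).  The ZONES of `O`
are the blue bare clusters (`BlueBareConn`, `zone`); a zone is RC (`Rc`) when its red bare graph is connected; `K` =
the red bare cluster `BareReach a b c O` of the probe.  The PORT VERTICES are the vertices of `K` carrying a terminal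
edge; the PORT ZONE of such a vertex `v` is its zone when that zone is rc and is not the zone of `c` (SWITCHABLE: it
may be attached to a terminal) and the singleton `{v}` otherwise (FORCED-FREE: in the family `𝒮_rc(O)` its edges stay
red).  `rcPort O : ZonePort.Problem V (TermEdge O)` is the zone port problem of `C041ZonePortDefs` read off `O`: the
graph = the red bare adjacency of `O`, root set `{c}`, the port zones, and the terminal edges at the port vertices
(`TermEdge O`) with `tv` = the port vertex, `ts` = «at `b`», `tz` = the port zone of `tv`.

This file has the definitions and the structural facts (zones are an equivalence relation, `Rc` is a zone property,
an rc zone meeting `K` lies in `K`, port zones are pairwise disjoint and internally connected, the terms are exactly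
the terminal edges at the port vertices).  The dictionaries `Good_t S ↔ Good_t (patternOf S)` and the count are the
next modules.
-/

namespace PercRepro

namespace MultiGraph

open Finset ZonePort

variable {V E : Type*} (G : MultiGraph V E)

/-- Blue bare adjacency of `O`. -/
def BlueBareAdj (a b : V) (O : Config E) (u v : V) : Prop := ∃ e, G.Bare a b e ∧ O e = false ∧ G.Joins e u v

/-- Blue bare connectivity of `O`: `u` and `v` lie in the same zone. -/
def BlueBareConn (a b : V) (O : Config E) (u v : V) : Prop :=
  Relation.ReflTransGen (G.BlueBareAdj a b O) u v

variable {G}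

/-- Blue bare adjacency is symmetric. -/
theorem BlueBareAdj.symm {a b : V} {O : Config E} {u v : V} (h : G.BlueBareAdj a b O u v) :
    G.BlueBareAdj a b O v u := by
  obtain ⟨e, he, hO, hj⟩ := h
  exact ⟨e, he, hO, hj.symm⟩

/-- Zones: reflexivity. -/
theorem BlueBareConn.refl (a b : V) (O : Config E) (u : V) : G.BlueBareConn a b O u u :=
  Relation.ReflTransGen.refl

/-- Zones: transitivity. -/
theorem BlueBareConn.trans {a b : V} {O : Config E} {u v w : V} (h₁ : G.BlueBareConn a b O u v)
    (h₂ : G.BlueBareConn a b O v w) : G.BlueBareConn a b O u w :=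
  Relation.ReflTransGen.trans h₁ h₂

/-- Zones: symmetry. -/
theorem BlueBareConn.symm {a b : V} {O : Config E} {u v : V} (h : G.BlueBareConn a b O u v) :
    G.BlueBareConn a b O v u := by
  induction h with
  | refl => exact Relation.ReflTransGen.refl
  | tail _ hbc ih => exact Relation.ReflTransGen.head hbc.symm ih

/-- A blue bare step. -/
theorem BlueBareConn.single {a b : V} {O : Config E} {u v : V} (h : G.BlueBareAdj a b O u v) :
    G.BlueBareConn a b O u v :=
  Relation.ReflTransGen.single h

/-- A blue bare walk is a blue walk of every configuration agreeing with `O` on the bare edges. -/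
theorem conn_compl_of_blueBareConn {a b : V} {O S : Config E} (hagree : G.AgreeBare a b O S) {u v : V}
    (h : G.BlueBareConn a b O u v) : G.Conn Sᶜ u v := by
  induction h with
  | refl => exact Conn.refl G _ u
  | tail _ hbc ih =>
    obtain ⟨e, he, hO, hj⟩ := hbc
    refine ih.trans (Conn.of_openAdj ⟨e, ?_, hj⟩)
    rw [compl_apply_not, hagree e he, hO]
    rfl

/-- The ends of a blue bare walk from a non-terminal are non-terminals. -/
theorem ne_terminal_of_blueBareConn {a b : V} {O : Config E} {u v : V} (h : G.BlueBareConn a b O u v)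
    (hu : u ≠ a ∧ u ≠ b) : v ≠ a ∧ v ≠ b := by
  induction h with
  | refl => exact hu
  | tail _ hbc _ =>
    obtain ⟨e, he, _, hj⟩ := hbc
    exact (ne_of_bare_joins he hj).2

section Zones

variable [Fintype V] (a b c : V) (O : Config E)

open Classical in
/-- The zone of `v`: its blue bare cluster. -/
noncomputable def zone (v : V) : Finset V := univ.filter fun u => G.BlueBareConn a b O v u

/-- Membership in a zone. -/
theorem mem_zone {v u : V} : u ∈ G.zone a b O v ↔ G.BlueBareConn a b O v u := by
  unfold zone
  simp only [mem_filter, mem_univ, true_and]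

/-- A vertex lies in its zone. -/
theorem self_mem_zone (v : V) : v ∈ G.zone a b O v := (mem_zone a b O).2 (BlueBareConn.refl a b O v)

/-- Zones of blue-bare-connected vertices coincide. -/
theorem zone_eq_of_blueBareConn {v w : V} (h : G.BlueBareConn a b O v w) : G.zone a b O v = G.zone a b O w := by
  ext u
  rw [mem_zone, mem_zone]
  exact ⟨fun h' => h.symm.trans h', fun h' => h.trans h'⟩

/-- The zone of a member is the zone. -/
theorem zone_eq_of_mem {v w : V} (h : w ∈ G.zone a b O v) : G.zone a b O w = G.zone a b O v :=
  (zone_eq_of_blueBareConn a b O ((mem_zone a b O).1 h)).symm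

/-- Two zones are equal or disjoint. -/
theorem zone_eq_or_disjoint (v w : V) :
    G.zone a b O v = G.zone a b O w ∨ ∀ u ∈ G.zone a b O v, u ∉ G.zone a b O w := by
  by_cases h : G.BlueBareConn a b O v w
  · exact Or.inl (zone_eq_of_blueBareConn a b O h)
  · right
    intro u hu hu'
    rw [mem_zone] at hu hu'
    exact h (hu.trans hu'.symm)

/-- An rc zone: the red bare graph of `O` restricted to the zone of `v` is connected. -/
def Rc (v : V) : Prop :=
  ∀ u ∈ G.zone a b O v, ∀ w ∈ G.zone a b O v,
    Relation.ReflTransGen (fun p q => G.BareAdj a b O p q ∧ p ∈ G.zone a b O v ∧ q ∈ G.zone a b O v) u w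

/-- `Rc` is a property of the zone. -/
theorem rc_of_mem {v w : V} (h : w ∈ G.zone a b O v) (hv : G.Rc a b O v) : G.Rc a b O w := by
  unfold Rc
  rw [zone_eq_of_mem a b O h]
  exact hv

/-- **An rc zone meeting `K` lies in `K`**: its internal red connections join it to `K`. -/
theorem mem_bareReach_of_rc {v : V} (hv : G.Rc a b O v) {u : V} (hu : u ∈ G.zone a b O v)
    (huK : u ∈ G.BareReach a b c O) {w : V} (hw : w ∈ G.zone a b O v) : w ∈ G.BareReach a b c O :=
  Relation.ReflTransGen.trans huK (reflTransGen_mono' (fun _ _ h => h.1) (hv u hu w hw))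

/-- A port vertex: a vertex of `K` carrying a terminal edge. -/
def IsPortVert (v : V) : Prop :=
  v ∈ G.BareReach a b c O ∧ ∃ e, G.Joins e v a ∨ G.Joins e v b

/-- A switchable zone: rc and not the zone of the probe. -/
def Switchable (v : V) : Prop := G.Rc a b O v ∧ ¬ G.BlueBareConn a b O c v

/-- `Switchable` is a property of the zone. -/
theorem switchable_of_mem {v w : V} (h : w ∈ G.zone a b O v) (hv : G.Switchable a b c O v) :
    G.Switchable a b c O w := by
  refine ⟨rc_of_mem a b O h hv.1, fun hcw => hv.2 ?_⟩
  exact hcw.trans ((mem_zone a b O).1 h).symm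

open Classical in
/-- The port zone of a vertex: its zone when switchable, the singleton otherwise. -/
noncomputable def portZone (v : V) : Finset V :=
  if G.Switchable a b c O v then G.zone a b O v else {v}

/-- A vertex lies in its port zone. -/
theorem self_mem_portZone (v : V) : v ∈ G.portZone a b c O v := by
  unfold portZone
  split_ifs
  · exact self_mem_zone a b O v
  · exact Finset.mem_singleton_self v

/-- The port zone of a switchable vertex. -/
theorem portZone_of_switchable {v : V} (h : G.Switchable a b c O v) : G.portZone a b c O v = G.zone a b O v := by
  unfold portZone
  rw [if_pos h]

/-- The port zone of a non-switchable vertex. -/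
theorem portZone_of_not_switchable {v : V} (h : ¬ G.Switchable a b c O v) : G.portZone a b c O v = {v} := by
  unfold portZone
  rw [if_neg h]

/-- A port zone is contained in the zone. -/
theorem portZone_subset_zone (v : V) : G.portZone a b c O v ⊆ G.zone a b O v := by
  unfold portZone
  split_ifs
  · exact Finset.Subset.refl _
  · intro u hu
    rw [Finset.mem_singleton] at hu
    rw [hu]
    exact self_mem_zone a b O v

/-- A member of a port zone has the same port zone. -/
theorem portZone_eq_of_mem {v w : V} (h : w ∈ G.portZone a b c O v) :
    G.portZone a b c O w = G.portZone a b c O v := by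
  by_cases hv : G.Switchable a b c O v
  · rw [portZone_of_switchable a b c O hv] at h ⊢
    rw [portZone_of_switchable a b c O (switchable_of_mem a b c O h hv)]
    exact zone_eq_of_mem a b O h
  · rw [portZone_of_not_switchable a b c O hv, Finset.mem_singleton] at h
    rw [h]

/-- **Port zones are equal or disjoint.** -/
theorem portZone_eq_or_disjoint (v w : V) :
    G.portZone a b c O v = G.portZone a b c O w ∨ ∀ u ∈ G.portZone a b c O v, u ∉ G.portZone a b c O w := by
  by_cases h : ∃ u, u ∈ G.portZone a b c O v ∧ u ∈ G.portZone a b c O w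
  · obtain ⟨u, hu, hu'⟩ := h
    exact Or.inl ((portZone_eq_of_mem a b c O hu).symm.trans (portZone_eq_of_mem a b c O hu'))
  · right
    intro u hu hu'
    exact h ⟨u, hu, hu'⟩

/-- A port zone is internally red-connected. -/
theorem portZone_conn (v : V) : ∀ u ∈ G.portZone a b c O v, ∀ w ∈ G.portZone a b c O v,
    Relation.ReflTransGen (fun p q => G.BareAdj a b O p q ∧ p ∈ G.portZone a b c O v ∧ q ∈ G.portZone a b c O v)
      u w := by
  intro u hu w hw
  by_cases hv : G.Switchable a b c O v
  · rw [portZone_of_switchable a b c O hv] at hu hw ⊢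
    exact hv.1 u hu w hw
  · rw [portZone_of_not_switchable a b c O hv, Finset.mem_singleton] at hu hw
    rw [hu, hw]

/-- The port zone of a port vertex lies in `K`. -/
theorem portZone_subset_bareReach {v : V} (hv : v ∈ G.BareReach a b c O) :
    ∀ u ∈ G.portZone a b c O v, u ∈ G.BareReach a b c O := by
  intro u hu
  by_cases hs : G.Switchable a b c O v
  · rw [portZone_of_switchable a b c O hs] at hu
    exact mem_bareReach_of_rc a b c O hs.1 (self_mem_zone a b O v) hv hu
  · rw [portZone_of_not_switchable a b c O hs, Finset.mem_singleton] at hu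
    rw [hu]
    exact hv

end Zones

end MultiGraph

end PercRepro
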